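import Summits.HodgeConjecture.HodgeConjecture.Theorems.HolomorphicityRateLefschetzNewtonModel
import Literature.AlgebraicGeometry.HodgeTheory.GAGADimensionConverse
import HarnessLib

/-!
# Route HolomorphicityRate — crux `SuperThresholdRigidity` (stmt-HodgeConjecture-2737), stub B1:
# algebraic classes are analytically supported in codimension `≥ p`

Registered stub `stub_analyticSupportOfAlgebraic` of the skeleton
`Cruxes/SuperThresholdRigidity/Lines/birth.lean` (line `registered`), signature verbatim. For `X`
smooth projective of dimension `n` over `ℂ`, every Hodge model `A` (`A.carrier = X^an`, comparison
map `φ = A.toComplexPoints : X^an → X(ℂ)`), every `p` and every coniveau-`p` class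
`c ∈ algebraicClasses X p = Nᵖ H²ᵖ(X(ℂ); ℂ)` (the classes dying off some Zariski-closed `Z ⊆ X` all
of whose points have codimension `≥ p`), the class `c` is ANALYTICALLY supported in codimension
`≥ p` on `A` (`IsAnalyticallySupported A p c`): its pull-back `φ^* c` dies off a closed analytic
subset `S ⊆ X^an` all of whose regular points have complex codimension `≥ p`.

This is Serre's GAGA, §2 n°5 Lemme 1 b) (Zariski-closed ⟹ analytic) with §6 Prop. 3 Cor. 2–3
(comparison of dimensions), both proved in the tree; the file only assembles them, with
`S = φ⁻¹(Z(ℂ))`: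

* `Literature.AlgebraicGeometry.HodgeTheory.mem_supportedClasses_iff_exists` — the Zariski-closed
  support `Z` of codimension `≥ p` with `c|_{(X ∖ Z)(ℂ)} = 0`;
* `Literature.AlgebraicGeometry.HodgeTheory.isAnalyticSet_preimage_setOf_pt_mem` — `φ⁻¹(Z(ℂ))` is
  analytic (GAGA §2 n°5; needs `X` locally of finite type, here from properness,
  `IsSmoothProjective.isProper_holds`);
* `Literature.AlgebraicGeometry.HodgeTheory.le_regularLocus_codim_of_le_coheight` — the regular
  points of `φ⁻¹(Z(ℂ))` have complex codimension `≥ p` (GAGA §6, converse dimension comparison);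
* `Summit.HodgeConjecture.HodgeConjecture.Theorems.map_compl_pullback_eq_zero_of_restrictCompl_eq_zero`
  — transport of the vanishing from `(X ∖ Z)(ℂ)` to `X^an ∖ φ⁻¹(Z(ℂ))`.

The `p = 1` case was landed earlier as `isAnalyticallySupported_one_of_mem_algebraicClasses` (file
`HolomorphicityRateLefschetzNewtonModel`) through the detour `S ≠ X^an`; for general `p` the
codimension bound comes directly from `le_regularLocus_codim_of_le_coheight`, so no connectedness or
generic-point argument is needed.

## References

* J.-P. Serre, *Géométrie algébrique et géométrie analytique* (1956), §2 n°5 Lemme 1 b), §6 Prop. 3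
  Cor. 2–3. [SerreGAGA1956]
* C. Voisin, *Hodge Theory and Complex Algebraic Geometry I* (2002), §11.1.2. [VoisinHodgeI2002]
-/

-- `Summit.HodgeConjecture.HodgeConjecture.Theorems` is the mandated namespace (single-problem summit:
-- Problem = Summit), which `linter.dupNamespace` flags on every declaration; the lakefile turns the
-- linter off tree-wide (weak option), restated here so stand-alone elaboration is warning-free too.
set_option linter.dupNamespace false

noncomputable section

namespace Summit.HodgeConjecture.HodgeConjecture.Theorems

open scoped Manifold ContDiff Topology
open Literature.AlgebraicGeometry.HodgeTheory Literature.AlgebraicGeometry.Motives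
  Literature.AlgebraicTopology.SingularHomology Literature.Geometry.Kaehler

/-- **Coniveau-`p` classes are analytically supported in codimension `≥ p` on a fixed support.**
For `X` smooth projective of dimension `n` over `ℂ`, a Hodge model `A` with comparison map
`φ : X^an → X(ℂ)`, a Zariski-closed `Z ⊆ X` all of whose points have codimension `≥ p`, and a class
`c ∈ Hᵏ(X(ℂ); ℂ)` dying on `(X ∖ Z)(ℂ)`: the subset `S = φ⁻¹(Z(ℂ)) ⊆ X^an` is analytic
(GAGA §2 n°5 Lemme 1 b), `isAnalyticSet_preimage_setOf_pt_mem`), its regular points have complex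
codimension `≥ p` (GAGA §6 Prop. 3 Cor. 2–3, `le_regularLocus_codim_of_le_coheight`), and `φ^* c`
dies on `X^an ∖ S` (`map_compl_pullback_eq_zero_of_restrictCompl_eq_zero`).
[cite: SerreGAGA1956, §2 n°5 Lemme 1 b) and §6 Prop. 3 Cor. 2–3] -/
theorem isAnalyticallySupported_of_restrictCompl_eq_zero {n : ℕ} {X : SchemeOver ℂ}
    (hX : IsSmoothProjective n X) (A : HodgeModel n X) (p : ℕ) {k : ℕ} {Z : Set X.left}
    (hZ : IsClosed Z) (hcoh : ∀ z ∈ Z, (p : ℕ∞) ≤ Order.coheight z) (c : complexBetti X k)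
    (h0 : complexBetti.restrictCompl X Z k c = 0) : IsAnalyticallySupported A p c := by
  haveI : AlgebraicGeometry.IsProper X.hom := IsSmoothProjective.isProper_holds hX
  exact ⟨A.toComplexPoints ⁻¹' {P | P.pt ∈ Z},
    ⟨isAnalyticSet_preimage_setOf_pt_mem A.isAnalytification hZ,
      le_regularLocus_codim_of_le_coheight hX A.isAnalytification p Z hZ hcoh⟩,
    map_compl_pullback_eq_zero_of_restrictCompl_eq_zero A rfl c h0⟩

/-- **Stub B1 of crux `SuperThresholdRigidity` — algebraic classes are analytically supported in
codimension `≥ p`.** For `X` smooth projective of dimension `n` over `ℂ`, every Hodge model `A` of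
`X`, every `p` and every `c ∈ algebraicClasses X p = Nᵖ H²ᵖ(X(ℂ); ℂ)`, the class `c` is
analytically supported in codimension `≥ p` on `A` (`IsAnalyticallySupported A p c`): `c` dies off
a Zariski-closed `Z ⊆ X` all of whose points have codimension `≥ p`
(`mem_supportedClasses_iff_exists`); then `S = φ⁻¹(Z(ℂ)) ⊆ X^an` is a closed analytic subset
(Serre, GAGA §2 n°5 Lemme 1 b)) whose regular points have complex codimension `≥ p` (GAGA §6
Prop. 3 Cor. 2–3: analytic and algebraic dimensions agree), and `φ^* c` dies on `X^an ∖ S`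
(`isAnalyticallySupported_of_restrictCompl_eq_zero`).
[cite: SerreGAGA1956, §2 n°5 Lemme 1 b) and §6 Prop. 3 Cor. 2–3] -/
theorem stub_analyticSupportOfAlgebraic : ∀ (n p : ℕ) (X : Literature.AlgebraicGeometry.Motives.SchemeOver ℂ), Literature.AlgebraicGeometry.Motives.IsSmoothProjective n X → ∀ (A : Literature.AlgebraicGeometry.HodgeTheory.HodgeModel n X) (c : Literature.AlgebraicGeometry.HodgeTheory.complexBetti X (2 * p)), c ∈ Literature.AlgebraicGeometry.HodgeTheory.algebraicClasses X p → Literature.AlgebraicGeometry.HodgeTheory.IsAnalyticallySupported A p c := by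
  intro n p X hX A c hc
  obtain ⟨Z, hZ, hcoh, h0⟩ := mem_supportedClasses_iff_exists.1 hc
  exact isAnalyticallySupported_of_restrictCompl_eq_zero hX A p hZ hcoh c h0

end Summit.HodgeConjecture.HodgeConjecture.Theorems

end
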